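import Summits.MatrixMultiplication.MatrixMultiplication.Theorems.SoloInformedValTwoBlockU2N

/-!
# The normalised two-block bound with overlapping classes: one disjoint class pair suffices

Solo-informed MatrixMultiplication, gen 82 (dossier `paper/val-superlinear.md` §15.8 (n)(xvii); CLAIMS c600, c601);
a sequel to `SoloInformedValTwoBlockU2N`.

SETTING.  Two complete blocks `X₁ × Y₁ × Z₁`, `X₂ × Y₂ × Z₂` (identity potentials in a finite abelian group `G`,
pair graphs `blockPairs`), now with ONLY `Y₁ ∩ Y₂ = ∅`; both the row classes and the `K`-classes may overlap,
`o_X = |X₁ ∩ X₂|`, `o_Z = |Z₁ ∩ Z₂|`.  Of the three edges of a triangle of the pair graphs two lie in the same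
block, so the triangles are exactly the two boxes (`triangleSet_blockPairs_eq`, no hypothesis) and
`T = v₁ + v₂` as soon as one class pair is disjoint (`card_triangleSet_blockPairs_of_disjointY`).

THE TWO OVERLAP INEQUALITIES (both from `Y₁ ∩ Y₂ = ∅` alone).  For an accidental-free union,

  `v₁ + o_X·|Y₂||Z₂| ≤ n`  (`NoAccidental.volume_add_overlap_le`, previous file: `M_111 ⊥ M_122`),
  `v₁ + o_Z·|X₂||Y₂| ≤ n`  (`NoAccidental.volume_add_overlapZ_le`: the mirrored images `M'_111 = Y₁ - Z₁ - X₁`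
                            and `M'_221 = Y₂ - Z₁ - X₂ ⊇ Y₂ - (Z₁ ∩ Z₂) - X₂` are disjoint),

and the two block-swapped ones.

THE LINEAR BUDGET (`lin_volume_le`).  `0 ≤ o ≤ x₁, x₂`, `w_s ≥ 0`, `v_s = x_s w_s`, `x₁w₁ + o w₂ ≤ n` and
`x₂w₂ + o w₁ ≤ n` imply `x₁v₁ + x₂v₂ ≤ n(x₁ + x₂ - o)`: if `x₁ ≥ x₂` then `x₁(n - v₁) ≥ x₁ o w₂ ≥ x₂ o w₂ = o v₂`
and `x₂(n - v₂) ≥ o(n - v₂)`.  (It implies the squared-volume lemma `sq_volume_le` of the previous file, since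
`v_s ≤ n`.)  Hence `Σ_s |X_s| v_s ≤ n|X₁ ∪ X₂|` and `Σ_s |Z_s| v_s ≤ n|Z₁ ∪ Z₂|`, and the two-term Hölder
inequality with `a_s = |X_s| v_s`, `b_s = |Y_s|`, `c_s = |Z_s| v_s` (`a_s b_s c_s = v_s³`) gives

THE THEOREM (`NoAccidental.card_triangleSet_pow_three_le_of_disjointY`, and by the cyclic symmetry
`NoAccidental.rotate` of accidental-freeness also `…_of_disjointZ`, `…_of_disjointX`,
`NoAccidental.card_triangleSet_pow_three_le_of_disjoint`):  for every accidental-free union of two complete blocks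
in which at least ONE of the three class pairs is disjoint,

  `T³ ≤ |G|² · |X₁ ∪ X₂| · |Y₁ ∪ Y₂| · |Z₁ ∪ Z₂|`.

(The case in which all three class pairs meet — the two boxes then share the sub-box
`(X₁ ∩ X₂) × (Y₁ ∩ Y₂) × (Z₁ ∩ Z₂)` — is not treated here.)  No `sorry`.
-/

namespace Summit.MatrixMultiplication.MatrixMultiplication.Theorems.SoloVal

open Finset

/-! ### The linear budget and the numeric criterion -/

section RealLemmas

/-- THE LINEAR BUDGET.  `0 ≤ o ≤ x₁, x₂`, `w_s ≥ 0`, `x₁w₁ + o w₂ ≤ n` and `x₂w₂ + o w₁ ≤ n` imply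
`x₁(x₁w₁) + x₂(x₂w₂) ≤ n(x₁ + x₂ - o)`. -/
theorem lin_volume_le {n o x₁ x₂ w₁ w₂ : ℝ} (ho : 0 ≤ o) (hox₁ : o ≤ x₁) (hox₂ : o ≤ x₂) (hw₁ : 0 ≤ w₁)
    (hw₂ : 0 ≤ w₂) (hA : x₁ * w₁ + o * w₂ ≤ n) (hB : x₂ * w₂ + o * w₁ ≤ n) :
    x₁ * (x₁ * w₁) + x₂ * (x₂ * w₂) ≤ n * (x₁ + x₂ - o) := by
  have hx₁ : 0 ≤ x₁ := ho.trans hox₁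
  have hx₂ : 0 ≤ x₂ := ho.trans hox₂
  rcases le_total x₂ x₁ with h | h
  · have e1 : x₁ * (x₁ * w₁ + o * w₂) ≤ x₁ * n := mul_le_mul_of_nonneg_left hA hx₁
    have e2 : x₂ * (o * w₂) ≤ x₁ * (o * w₂) := mul_le_mul_of_nonneg_right h (mul_nonneg ho hw₂)
    have e3 : o * (n - x₂ * w₂) ≤ x₂ * (n - x₂ * w₂) :=
      mul_le_mul_of_nonneg_right hox₂ (by nlinarith [mul_nonneg ho hw₁])
    nlinarith [e1, e2, e3]
  · have e1 : x₂ * (x₂ * w₂ + o * w₁) ≤ x₂ * n := mul_le_mul_of_nonneg_left hB hx₂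
    have e2 : x₁ * (o * w₁) ≤ x₂ * (o * w₁) := mul_le_mul_of_nonneg_right h (mul_nonneg ho hw₁)
    have e3 : o * (n - x₁ * w₁) ≤ x₁ * (n - x₁ * w₁) :=
      mul_le_mul_of_nonneg_right hox₁ (by nlinarith [mul_nonneg ho hw₂])
    nlinarith [e1, e2, e3]

/-- THE NUMERIC CRITERION WITH TWO OVERLAPS.  Natural numbers with `x₁y₁z₁ + a·y₂z₂ ≤ n`, `x₂y₂z₂ + a·y₁z₁ ≤ n`,
`x₁y₁z₁ + x₂y₂·c ≤ n`, `x₂y₂z₂ + x₁y₁·c ≤ n`, `a ≤ x₁, x₂`, `c ≤ z₁, z₂`, `i + a = x₁ + x₂`, `k + c = z₁ + z₂`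
satisfy `(x₁y₁z₁ + x₂y₂z₂)³ ≤ n²·i·(y₁ + y₂)·k`. -/
theorem cube_le_of_overlaps {n x₁ y₁ z₁ x₂ y₂ z₂ a c i k : ℕ} (hA : x₁ * y₁ * z₁ + a * y₂ * z₂ ≤ n)
    (hB : x₂ * y₂ * z₂ + a * y₁ * z₁ ≤ n) (hC : x₁ * y₁ * z₁ + x₂ * y₂ * c ≤ n)
    (hD : x₂ * y₂ * z₂ + x₁ * y₁ * c ≤ n) (ha₁ : a ≤ x₁) (ha₂ : a ≤ x₂) (hc₁ : c ≤ z₁) (hc₂ : c ≤ z₂)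
    (hi : i + a = x₁ + x₂) (hk : k + c = z₁ + z₂) :
    (x₁ * y₁ * z₁ + x₂ * y₂ * z₂) ^ 3 ≤ n ^ 2 * i * (y₁ + y₂) * k := by
  have hA' : (x₁ : ℝ) * ((y₁ : ℝ) * z₁) + (a : ℝ) * ((y₂ : ℝ) * z₂) ≤ n := by
    have h := (Nat.cast_le (α := ℝ)).mpr hA
    push_cast at h
    nlinarith [h]
  have hB' : (x₂ : ℝ) * ((y₂ : ℝ) * z₂) + (a : ℝ) * ((y₁ : ℝ) * z₁) ≤ n := by
    have h := (Nat.cast_le (α := ℝ)).mpr hB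
    push_cast at h
    nlinarith [h]
  have hC' : (z₁ : ℝ) * ((x₁ : ℝ) * y₁) + (c : ℝ) * ((x₂ : ℝ) * y₂) ≤ n := by
    have h := (Nat.cast_le (α := ℝ)).mpr hC
    push_cast at h
    nlinarith [h]
  have hD' : (z₂ : ℝ) * ((x₂ : ℝ) * y₂) + (c : ℝ) * ((x₁ : ℝ) * y₁) ≤ n := by
    have h := (Nat.cast_le (α := ℝ)).mpr hD
    push_cast at h
    nlinarith [h]
  have ha₁' : (a : ℝ) ≤ x₁ := by exact_mod_cast ha₁
  have ha₂' : (a : ℝ) ≤ x₂ := by exact_mod_cast ha₂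
  have hc₁' : (c : ℝ) ≤ z₁ := by exact_mod_cast hc₁
  have hc₂' : (c : ℝ) ≤ z₂ := by exact_mod_cast hc₂
  have hi' : (i : ℝ) = x₁ + x₂ - a := by
    have h := congrArg (Nat.cast (R := ℝ)) hi
    push_cast at h
    linarith
  have hk' : (k : ℝ) = z₁ + z₂ - c := by
    have h := congrArg (Nat.cast (R := ℝ)) hk
    push_cast at h
    linarith
  have LX := lin_volume_le (Nat.cast_nonneg a) ha₁' ha₂' (by positivity) (by positivity) hA' hB'
  have LZ := lin_volume_le (Nat.cast_nonneg c) hc₁' hc₂' (by positivity) (by positivity) hC' hD'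
  have H := cube_add_le_mul_mul (v₁ := (x₁ : ℝ) * y₁ * z₁) (v₂ := (x₂ : ℝ) * y₂ * z₂)
    (a₁ := (x₁ : ℝ) * ((x₁ : ℝ) * ((y₁ : ℝ) * z₁))) (a₂ := (x₂ : ℝ) * ((x₂ : ℝ) * ((y₂ : ℝ) * z₂)))
    (b₁ := (y₁ : ℝ)) (b₂ := (y₂ : ℝ))
    (c₁ := (z₁ : ℝ) * ((z₁ : ℝ) * ((x₁ : ℝ) * y₁))) (c₂ := (z₂ : ℝ) * ((z₂ : ℝ) * ((x₂ : ℝ) * y₂)))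
    (by positivity) (by positivity) (by positivity) (by positivity) (by positivity) (by positivity)
    (by positivity) (by positivity) (by ring) (by ring)
  have hy : (0 : ℝ) ≤ (y₁ : ℝ) + y₂ := by positivity
  have hI : (0 : ℝ) ≤ (n : ℝ) * ((x₁ : ℝ) + x₂ - a) := le_trans (by positivity) LX
  have key : ((x₁ : ℝ) * y₁ * z₁ + x₂ * y₂ * z₂) ^ 3 ≤ (n : ℝ) ^ 2 * i * (y₁ + y₂) * k :=
    calc ((x₁ : ℝ) * y₁ * z₁ + x₂ * y₂ * z₂) ^ 3
        ≤ ((x₁ : ℝ) * ((x₁ : ℝ) * ((y₁ : ℝ) * z₁)) + (x₂ : ℝ) * ((x₂ : ℝ) * ((y₂ : ℝ) * z₂)))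
            * ((y₁ : ℝ) + y₂)
            * ((z₁ : ℝ) * ((z₁ : ℝ) * ((x₁ : ℝ) * y₁)) + (z₂ : ℝ) * ((z₂ : ℝ) * ((x₂ : ℝ) * y₂))) := H
      _ ≤ (n : ℝ) * ((x₁ : ℝ) + x₂ - a) * ((y₁ : ℝ) + y₂) * ((n : ℝ) * ((z₁ : ℝ) + z₂ - c)) :=
          mul_le_mul (mul_le_mul_of_nonneg_right LX hy) LZ (by positivity) (mul_nonneg hI hy)
      _ = (n : ℝ) ^ 2 * i * (y₁ + y₂) * k := by rw [hi', hk']; ring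
  exact_mod_cast key

end RealLemmas

/-! ### Triangles, the second overlap inequality, and the theorem -/

section TwoBlockOverlap

variable {G : Type*} [AddCommGroup G] [DecidableEq G]
variable {X₁ Y₁ Z₁ X₂ Y₂ Z₂ : Finset G}

omit [AddCommGroup G] in
/-- For two complete blocks the triangles of the pair graphs are exactly the two boxes (no hypothesis: two of
the three edges of a triangle come from the same block, which pins all three coordinates to that block). -/
theorem triangleSet_blockPairs_eq :
    triangleSet (blockPairs X₁ Y₁ X₂ Y₂) (blockPairs Y₁ Z₁ Y₂ Z₂) (blockPairs Z₁ X₁ Z₂ X₂) =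
      X₁ ×ˢ Y₁ ×ˢ Z₁ ∪ X₂ ×ˢ Y₂ ×ˢ Z₂ := by
  ext ⟨i, j, k⟩
  rw [mem_triangleSet, IsTriangle, mem_blockPairs, mem_blockPairs, mem_blockPairs, Finset.mem_union,
    Finset.mem_product, Finset.mem_product, Finset.mem_product, Finset.mem_product]
  simp only
  constructor
  · rintro ⟨hij | hij, hjk | hjk, hki | hki⟩
    · exact Or.inl ⟨hij.1, hij.2, hjk.2⟩
    · exact Or.inl ⟨hij.1, hij.2, hjk.2⟩
    · exact Or.inl ⟨hij.1, hij.2, hki.1⟩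
    · exact Or.inr ⟨hki.2, hjk.1, hjk.2⟩
    · exact Or.inl ⟨hki.2, hjk.1, hjk.2⟩
    · exact Or.inr ⟨hij.1, hij.2, hki.1⟩
    · exact Or.inr ⟨hij.1, hij.2, hjk.2⟩
    · exact Or.inr ⟨hij.1, hij.2, hjk.2⟩
  · rintro (⟨hi, hj, hk⟩ | ⟨hi, hj, hk⟩)
    · exact ⟨Or.inl ⟨hi, hj⟩, Or.inl ⟨hj, hk⟩, Or.inl ⟨hk, hi⟩⟩
    · exact ⟨Or.inr ⟨hi, hj⟩, Or.inr ⟨hj, hk⟩, Or.inr ⟨hk, hi⟩⟩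

omit [AddCommGroup G] in
/-- With `Y₁ ∩ Y₂ = ∅` (rows and `K`-classes arbitrary) the two boxes are disjoint: `T = v₁ + v₂`. -/
theorem card_triangleSet_blockPairs_of_disjointY (hY : Disjoint Y₁ Y₂) :
    (triangleSet (blockPairs X₁ Y₁ X₂ Y₂) (blockPairs Y₁ Z₁ Y₂ Z₂) (blockPairs Z₁ X₁ Z₂ X₂)).card =
      X₁.card * Y₁.card * Z₁.card + X₂.card * Y₂.card * Z₂.card := by
  rw [triangleSet_blockPairs_eq]
  have hd : Disjoint (X₁ ×ˢ Y₁ ×ˢ Z₁) (X₂ ×ˢ Y₂ ×ˢ Z₂) := by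
    rw [Finset.disjoint_left]
    rintro ⟨i, j, k⟩ h1 h2
    rw [Finset.mem_product, Finset.mem_product] at h1 h2
    exact Finset.disjoint_left.mp hY h1.2.1 h2.2.1
  rw [Finset.card_union_of_disjoint hd, Finset.card_product, Finset.card_product, Finset.card_product,
    Finset.card_product, Nat.mul_assoc, Nat.mul_assoc]

omit [AddCommGroup G] in
/-- With `Z₁ ∩ Z₂ = ∅` (the other classes arbitrary): `T = v₁ + v₂`. -/
theorem card_triangleSet_blockPairs_of_disjointZ (hZ : Disjoint Z₁ Z₂) :
    (triangleSet (blockPairs X₁ Y₁ X₂ Y₂) (blockPairs Y₁ Z₁ Y₂ Z₂) (blockPairs Z₁ X₁ Z₂ X₂)).card =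
      X₁.card * Y₁.card * Z₁.card + X₂.card * Y₂.card * Z₂.card := by
  rw [triangleSet_blockPairs_eq]
  have hd : Disjoint (X₁ ×ˢ Y₁ ×ˢ Z₁) (X₂ ×ˢ Y₂ ×ˢ Z₂) := by
    rw [Finset.disjoint_left]
    rintro ⟨i, j, k⟩ h1 h2
    rw [Finset.mem_product, Finset.mem_product] at h1 h2
    exact Finset.disjoint_left.mp hZ h1.2.2 h2.2.2
  rw [Finset.card_union_of_disjoint hd, Finset.card_product, Finset.card_product, Finset.card_product,
    Finset.card_product, Nat.mul_assoc, Nat.mul_assoc]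

omit [AddCommGroup G] in
/-- With `X₁ ∩ X₂ = ∅` (the other classes arbitrary): `T = v₁ + v₂`. -/
theorem card_triangleSet_blockPairs_of_disjointX (hX : Disjoint X₁ X₂) :
    (triangleSet (blockPairs X₁ Y₁ X₂ Y₂) (blockPairs Y₁ Z₁ Y₂ Z₂) (blockPairs Z₁ X₁ Z₂ X₂)).card =
      X₁.card * Y₁.card * Z₁.card + X₂.card * Y₂.card * Z₂.card := by
  rw [triangleSet_blockPairs_eq]
  have hd : Disjoint (X₁ ×ˢ Y₁ ×ˢ Z₁) (X₂ ×ˢ Y₂ ×ˢ Z₂) := by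
    rw [Finset.disjoint_left]
    rintro ⟨i, j, k⟩ h1 h2
    rw [Finset.mem_product, Finset.mem_product] at h1 h2
    exact Finset.disjoint_left.mp hX h1.1 h2.1
  rw [Finset.card_union_of_disjoint hd, Finset.card_product, Finset.card_product, Finset.card_product,
    Finset.card_product, Nat.mul_assoc, Nat.mul_assoc]

/-- Accidental-freeness of a two-block union is invariant under the cyclic rotation of the coordinates
`(X, Y, Z) ↦ (Y, Z, X)`. -/
theorem NoAccidental.rotate
    (hN : NoAccidental (id : G → G) id id (blockPairs X₁ Y₁ X₂ Y₂) (blockPairs Y₁ Z₁ Y₂ Z₂)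
      (blockPairs Z₁ X₁ Z₂ X₂)) :
    NoAccidental (id : G → G) id id (blockPairs Y₁ Z₁ Y₂ Z₂) (blockPairs Z₁ X₁ Z₂ X₂)
      (blockPairs X₁ Y₁ X₂ Y₂) := by
  intro i j j' k k' i' hij hjk hki h0
  have h0' : (id k' - id i') + (id i - id j) + (id j' - id k) = 0 := by
    rw [← h0]; abel
  obtain ⟨hk, hi, hj⟩ := hN k' i' i j j' k hki hij hjk h0'
  exact ⟨hi.symm, hj, hk.symm⟩

/-- Mirrored mixed images are monotone in the `Z`-class. -/
theorem mixedImageNeg_mono_right {X Y Z Z' : Finset G} (h : Z ⊆ Z') :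
    mixedImageNeg X Y Z ⊆ mixedImageNeg X Y Z' := by
  intro g hg
  obtain ⟨x, hx, y, hy, z, hz, rfl⟩ := mem_mixedImageNeg.mp hg
  exact mem_mixedImageNeg.mpr ⟨x, hx, y, hy, z, h hz, rfl⟩

/-- The sub-box `X₂ × Y₂ × (Z₁ ∩ Z₂)` of the TPP block 2 is uniquely represented inside `Y₂ - Z₁ - X₂`:
`|X₂||Y₂||Z₁ ∩ Z₂| ≤ |Y₂ - Z₁ - X₂|`. -/
theorem NoAccidental.card_mul_inter_le_card_mixedImageNeg
    (hN : NoAccidental (id : G → G) id id (blockPairs X₁ Y₁ X₂ Y₂) (blockPairs Y₁ Z₁ Y₂ Z₂)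
      (blockPairs Z₁ X₁ Z₂ X₂)) :
    X₂.card * Y₂.card * (Z₁ ∩ Z₂).card ≤ (mixedImageNeg X₂ Y₂ Z₁).card := by
  have hinj : Set.InjOn (fun t : G × G × G => t.2.1 - t.2.2 - t.1) ↑(X₂ ×ˢ Y₂ ×ˢ (Z₁ ∩ Z₂)) := by
    rintro ⟨x, y, z⟩ hm ⟨x', y', z'⟩ hm' heq
    simp only [Finset.coe_product, Set.mem_prod, Finset.mem_coe, Finset.mem_inter] at hm hm'
    have heq' : y - z - x = y' - z' - x' := heq
    have h0 : (x' - y') + (y - z) + (z' - x) = 0 :=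
      calc (x' - y') + (y - z) + (z' - x) = (y - z - x) - (y' - z' - x') := by abel
        _ = 0 := by rw [heq', sub_self]
    obtain ⟨hx, hy, hz⟩ := hN x' y' y z z' x (mem_blockPairs.mpr (Or.inr ⟨hm'.1, hm'.2.1⟩))
      (mem_blockPairs.mpr (Or.inr ⟨hm.2.1, hm.2.2.2⟩)) (mem_blockPairs.mpr (Or.inr ⟨hm'.2.2.2, hm.1⟩)) h0
    rw [← hx, ← hy, hz]
  calc X₂.card * Y₂.card * (Z₁ ∩ Z₂).card = (mixedImageNeg X₂ Y₂ (Z₁ ∩ Z₂)).card := by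
        unfold mixedImageNeg
        rw [Finset.card_image_of_injOn hinj, Finset.card_product, Finset.card_product, Nat.mul_assoc]
    _ ≤ (mixedImageNeg X₂ Y₂ Z₁).card :=
        Finset.card_le_card (mixedImageNeg_mono_right Finset.inter_subset_left)

/-- THE SECOND OVERLAP INEQUALITY: `|X₁||Y₁||Z₁| + |X₂||Y₂||Z₁ ∩ Z₂| ≤ |G|` for an accidental-free pair of
complete blocks with `Y₁ ∩ Y₂ = ∅` (`M'_111 ⊥ M'_221`; nothing is assumed about the other classes). -/
theorem NoAccidental.volume_add_overlapZ_le [Fintype G] (hY : Disjoint Y₁ Y₂)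
    (hN : NoAccidental (id : G → G) id id (blockPairs X₁ Y₁ X₂ Y₂) (blockPairs Y₁ Z₁ Y₂ Z₂)
      (blockPairs Z₁ X₁ Z₂ X₂)) :
    X₁.card * Y₁.card * Z₁.card + X₂.card * Y₂.card * (Z₁ ∩ Z₂).card ≤ Fintype.card G :=
  calc X₁.card * Y₁.card * Z₁.card + X₂.card * Y₂.card * (Z₁ ∩ Z₂).card
      ≤ (mixedImageNeg X₁ Y₁ Z₁).card + (mixedImageNeg X₂ Y₂ Z₁).card := by
        rw [hN.card_mixedImageNeg_block]
        exact Nat.add_le_add_left hN.card_mul_inter_le_card_mixedImageNeg _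
    _ = (mixedImageNeg X₁ Y₁ Z₁ ∪ mixedImageNeg X₂ Y₂ Z₁).card :=
        (Finset.card_union_of_disjoint (hN.disjoint_mixedImageNeg_111_221 hY)).symm
    _ ≤ Fintype.card G := Finset.card_le_univ _

/-- The second overlap inequality for the other block: `|X₂||Y₂||Z₂| + |X₁||Y₁||Z₁ ∩ Z₂| ≤ |G|`. -/
theorem NoAccidental.volume_add_overlapZ_le' [Fintype G] (hY : Disjoint Y₁ Y₂)
    (hN : NoAccidental (id : G → G) id id (blockPairs X₁ Y₁ X₂ Y₂) (blockPairs Y₁ Z₁ Y₂ Z₂)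
      (blockPairs Z₁ X₁ Z₂ X₂)) :
    X₂.card * Y₂.card * Z₂.card + X₁.card * Y₁.card * (Z₁ ∩ Z₂).card ≤ Fintype.card G := by
  rw [Finset.inter_comm]
  exact hN.swap_blocks.volume_add_overlapZ_le hY.symm

/-- THE NORMALISED TWO-BLOCK BOUND FROM ONE DISJOINT CLASS PAIR.  For an accidental-free union of two complete
blocks with `Y₁ ∩ Y₂ = ∅` (rows and `K`-classes arbitrary): `T³ ≤ |G|²·|X₁ ∪ X₂|·|Y₁ ∪ Y₂|·|Z₁ ∪ Z₂|`. -/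
theorem NoAccidental.card_triangleSet_pow_three_le_of_disjointY [Fintype G] (hY : Disjoint Y₁ Y₂)
    (hN : NoAccidental (id : G → G) id id (blockPairs X₁ Y₁ X₂ Y₂) (blockPairs Y₁ Z₁ Y₂ Z₂)
      (blockPairs Z₁ X₁ Z₂ X₂)) :
    (triangleSet (blockPairs X₁ Y₁ X₂ Y₂) (blockPairs Y₁ Z₁ Y₂ Z₂) (blockPairs Z₁ X₁ Z₂ X₂)).card ^ 3
      ≤ Fintype.card G ^ 2 * (X₁ ∪ X₂).card * (Y₁ ∪ Y₂).card * (Z₁ ∪ Z₂).card := by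
  rw [card_triangleSet_blockPairs_of_disjointY hY, Finset.card_union_of_disjoint hY]
  exact cube_le_of_overlaps (hN.volume_add_overlap_le hY) (hN.volume_add_overlap_le' hY)
    (hN.volume_add_overlapZ_le hY) (hN.volume_add_overlapZ_le' hY)
    (Finset.card_le_card Finset.inter_subset_left) (Finset.card_le_card Finset.inter_subset_right)
    (Finset.card_le_card Finset.inter_subset_left) (Finset.card_le_card Finset.inter_subset_right)
    (Finset.card_union_add_card_inter X₁ X₂) (Finset.card_union_add_card_inter Z₁ Z₂)

/-- The same bound when only `Z₁ ∩ Z₂ = ∅` is assumed (rotate the coordinates once). -/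
theorem NoAccidental.card_triangleSet_pow_three_le_of_disjointZ [Fintype G] (hZ : Disjoint Z₁ Z₂)
    (hN : NoAccidental (id : G → G) id id (blockPairs X₁ Y₁ X₂ Y₂) (blockPairs Y₁ Z₁ Y₂ Z₂)
      (blockPairs Z₁ X₁ Z₂ X₂)) :
    (triangleSet (blockPairs X₁ Y₁ X₂ Y₂) (blockPairs Y₁ Z₁ Y₂ Z₂) (blockPairs Z₁ X₁ Z₂ X₂)).card ^ 3
      ≤ Fintype.card G ^ 2 * (X₁ ∪ X₂).card * (Y₁ ∪ Y₂).card * (Z₁ ∪ Z₂).card := by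
  have h := hN.rotate.card_triangleSet_pow_three_le_of_disjointY hZ
  rw [card_triangleSet_blockPairs_of_disjointY hZ] at h
  rw [card_triangleSet_blockPairs_of_disjointZ hZ]
  calc (X₁.card * Y₁.card * Z₁.card + X₂.card * Y₂.card * Z₂.card) ^ 3
      = (Y₁.card * Z₁.card * X₁.card + Y₂.card * Z₂.card * X₂.card) ^ 3 := by ring
    _ ≤ Fintype.card G ^ 2 * (Y₁ ∪ Y₂).card * (Z₁ ∪ Z₂).card * (X₁ ∪ X₂).card := h
    _ = Fintype.card G ^ 2 * (X₁ ∪ X₂).card * (Y₁ ∪ Y₂).card * (Z₁ ∪ Z₂).card := by ring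

/-- The same bound when only `X₁ ∩ X₂ = ∅` is assumed (rotate the coordinates twice). -/
theorem NoAccidental.card_triangleSet_pow_three_le_of_disjointX [Fintype G] (hX : Disjoint X₁ X₂)
    (hN : NoAccidental (id : G → G) id id (blockPairs X₁ Y₁ X₂ Y₂) (blockPairs Y₁ Z₁ Y₂ Z₂)
      (blockPairs Z₁ X₁ Z₂ X₂)) :
    (triangleSet (blockPairs X₁ Y₁ X₂ Y₂) (blockPairs Y₁ Z₁ Y₂ Z₂) (blockPairs Z₁ X₁ Z₂ X₂)).card ^ 3
      ≤ Fintype.card G ^ 2 * (X₁ ∪ X₂).card * (Y₁ ∪ Y₂).card * (Z₁ ∪ Z₂).card := by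
  have h := hN.rotate.rotate.card_triangleSet_pow_three_le_of_disjointY hX
  rw [card_triangleSet_blockPairs_of_disjointY hX] at h
  rw [card_triangleSet_blockPairs_of_disjointX hX]
  calc (X₁.card * Y₁.card * Z₁.card + X₂.card * Y₂.card * Z₂.card) ^ 3
      = (Z₁.card * X₁.card * Y₁.card + Z₂.card * X₂.card * Y₂.card) ^ 3 := by ring
    _ ≤ Fintype.card G ^ 2 * (Z₁ ∪ Z₂).card * (X₁ ∪ X₂).card * (Y₁ ∪ Y₂).card := h
    _ = Fintype.card G ^ 2 * (X₁ ∪ X₂).card * (Y₁ ∪ Y₂).card * (Z₁ ∪ Z₂).card := by ring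

/-- THE NORMALISED TWO-BLOCK BOUND `T³ ≤ |G|²·|I|·|J|·|K|` for every accidental-free union of two complete blocks
in which at least one of the three class pairs is disjoint. -/
theorem NoAccidental.card_triangleSet_pow_three_le_of_disjoint [Fintype G]
    (hD : Disjoint X₁ X₂ ∨ Disjoint Y₁ Y₂ ∨ Disjoint Z₁ Z₂)
    (hN : NoAccidental (id : G → G) id id (blockPairs X₁ Y₁ X₂ Y₂) (blockPairs Y₁ Z₁ Y₂ Z₂)
      (blockPairs Z₁ X₁ Z₂ X₂)) :
    (triangleSet (blockPairs X₁ Y₁ X₂ Y₂) (blockPairs Y₁ Z₁ Y₂ Z₂) (blockPairs Z₁ X₁ Z₂ X₂)).card ^ 3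
      ≤ Fintype.card G ^ 2 * (X₁ ∪ X₂).card * (Y₁ ∪ Y₂).card * (Z₁ ∪ Z₂).card := by
  rcases hD with hX | hY | hZ
  · exact hN.card_triangleSet_pow_three_le_of_disjointX hX
  · exact hN.card_triangleSet_pow_three_le_of_disjointY hY
  · exact hN.card_triangleSet_pow_three_le_of_disjointZ hZ

end TwoBlockOverlap

end Summit.MatrixMultiplication.MatrixMultiplication.Theorems.SoloVal
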